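import Mathlib

/-!
# Congruence subgroups of an arbitrary matrix group and the finite-index clause of Lemma W, generic form (seat p5)

Blind re-derivation cell `pub-hodge-repro`, seat `p5`.  Mathlib only.

The generic form of `BallCongruence.lean`: the ambient group is ANY subgroup `𝒢 ≤ GL_n(F)` (`F` a commutative
ring) and the integral structure ANY injective ring map `φ : R →+* F`.  Contents:

* `conjSubG g Γ = g⁻¹ Γ g` for any group, `map_conjSubG` (conjugates transport along homomorphisms),
  `isFiniteRelIndex_map_inf_conjSubG` — **transport**: if `Γ ⊓ g⁻¹ Γ g` has finite index in `Γ`, so does its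
  image under an injective homomorphism;
* `arith 𝒢 φ = 𝒢(R)` — the elements of `𝒢` that are images of invertible `R`-matrices;
* `congr 𝒢 φ hφ K = Γ(K)` — the principal congruence subgroup of level `K ∈ R` (kernel of the reduction
  `𝒢(R) → GL_n(R/K)`), `isFiniteRelIndex_congr` (finite index when `R/K` is finite);
* `congr_le_conjSubG` — Hecke conjugation `Γ(N² M) ≤ g⁻¹ Γ(M) g` for `N · g`, `N · g⁻¹` integral;
* **`isFiniteRelIndex_inf_conjSubG`** — the finite-index clause: `Γ(M) ≤ Γ′ ≤ 𝒢(R)`, `R/(N² M)` finite ⇒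
  `Γ′ ⊓ g⁻¹ Γ′ g` has finite index in `Γ′`;
* `congr_le_inf_conjSubG` — the congruence half on its own: `Γ(N² M) ≤ Γ′ ⊓ g⁻¹ Γ′ g`.

Instantiated in `CongruenceHermitian.lean` for the unitary group of a Hermitian form over a CM field
(typer-2's `unitaryGroupOf`) and its image in `U(p,1)`.  Nothing here says anything about the status of the
Hodge conjecture for CM abelian varieties.
-/

set_option autoImplicit false

noncomputable section

universe u v

namespace Summit.Ventures.HodgeRepro

namespace CongGen

open Matrix

/-! ### Conjugate subgroups in any group, and transport along injective homomorphisms -/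

section conj

variable {G : Type u} [Group G]

/-- The conjugate subgroup `g⁻¹ Γ g = {δ : g δ g⁻¹ ∈ Γ}`. -/
def conjSubG (g : G) (Γ : Subgroup G) : Subgroup G := Γ.comap (MulAut.conj g).toMonoidHom

/-- `δ ∈ g⁻¹ Γ g ↔ g δ g⁻¹ ∈ Γ`. -/
theorem mem_conjSubG {g : G} {Γ : Subgroup G} {δ : G} : δ ∈ conjSubG g Γ ↔ g * δ * g⁻¹ ∈ Γ := Iff.rfl

/-- `g⁻¹ Γ g` is monotone in `Γ`. -/
theorem conjSubG_mono (g : G) {Γ₁ Γ₂ : Subgroup G} (h : Γ₁ ≤ Γ₂) : conjSubG g Γ₁ ≤ conjSubG g Γ₂ :=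
  Subgroup.comap_mono h

/-- Conjugate subgroups transport along homomorphisms: `ψ(g⁻¹ Γ g) = ψ(g)⁻¹ ψ(Γ) ψ(g)`. -/
theorem map_conjSubG {G' : Type v} [Group G'] (ψ : G →* G') (g : G) (Γ : Subgroup G) :
    (conjSubG g Γ).map ψ = conjSubG (ψ g) (Γ.map ψ) := by
  ext x
  constructor
  · rintro ⟨δ, hδ, rfl⟩
    have hδ' : g * δ * g⁻¹ ∈ Γ := hδ
    rw [mem_conjSubG]
    exact ⟨g * δ * g⁻¹, hδ', by simp [map_mul, map_inv]⟩
  · intro hx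
    rw [mem_conjSubG] at hx
    obtain ⟨y, hy, hyx⟩ := hx
    refine ⟨g⁻¹ * y * g, ?_, ?_⟩
    · show g * (g⁻¹ * y * g) * g⁻¹ ∈ Γ
      have : g * (g⁻¹ * y * g) * g⁻¹ = y := by group
      rw [this]
      exact hy
    · rw [map_mul, map_mul, map_inv, hyx]
      group

/-- **Transport of the finite-index clause** along an injective homomorphism `ψ`. -/
theorem isFiniteRelIndex_map_inf_conjSubG {G' : Type v} [Group G'] {ψ : G →* G'}
    (hψ : Function.Injective ψ) {Γ : Subgroup G} {g : G} (h : (Γ ⊓ conjSubG g Γ).IsFiniteRelIndex Γ) :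
    (Γ.map ψ ⊓ conjSubG (ψ g) (Γ.map ψ)).IsFiniteRelIndex (Γ.map ψ) := by
  rw [← map_conjSubG, ← Subgroup.map_inf _ _ _ hψ, Subgroup.isFiniteRelIndex_iff_relIndex_ne_zero,
    Subgroup.relIndex_map_map_of_injective _ _ hψ]
  exact h.relIndex_ne_zero

end conj

/-! ### Integral points, reduction, principal congruence subgroups -/

section cong

variable {n : Type} [Fintype n] [DecidableEq n] {F : Type u} [CommRing F] (𝒢 : Subgroup (GL n F))
  {R : Type v} [CommRing R] (φ : R →+* F)

/-- The matrix of an element of `𝒢`. -/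
abbrev matG (g : 𝒢) : Matrix n n F := ((g : GL n F) : Matrix n n F)

/-- `matG` is multiplicative. -/
theorem matG_mul (g h : 𝒢) : matG 𝒢 (g * h) = matG 𝒢 g * matG 𝒢 h := rfl

/-- `matG 1 = 1`. -/
theorem matG_one : matG 𝒢 (1 : 𝒢) = 1 := rfl

/-- `g g⁻¹ = 1` on matrices. -/
theorem matG_mul_inv (g : 𝒢) : matG 𝒢 g * matG 𝒢 g⁻¹ = 1 := by
  rw [← matG_mul, mul_inv_cancel, matG_one]

/-- `g⁻¹ g = 1` on matrices. -/
theorem matG_inv_mul (g : 𝒢) : matG 𝒢 g⁻¹ * matG 𝒢 g = 1 := by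
  rw [← matG_mul, inv_mul_cancel, matG_one]

/-- The ring map `M_n(R) → M_n(F)` induced by `φ`. -/
abbrev Mφ : Matrix n n R →+* Matrix n n F := φ.mapMatrix

/-- `φ` commutes with scalars: `Mφ (K • X) = φ K • Mφ X`. -/
theorem Mφ_smul (K : R) (X : Matrix n n R) : Mφ (n := n) φ (K • X) = φ K • Mφ φ X := by
  ext i j
  simp [Matrix.map_apply]

/-- The group map `GL_n(R) → GL_n(F)` induced by `φ`. -/
def ι : (Matrix n n R)ˣ →* GL n F := Units.map (Mφ (n := n) φ).toMonoidHom

/-- The matrix of `ι u` is the image of the matrix of `u`. -/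
theorem coe_ι (u : (Matrix n n R)ˣ) : ((ι (n := n) φ u : GL n F) : Matrix n n F) = Mφ φ (u : Matrix n n R) :=
  rfl

/-- `ι` is injective when `φ` is. -/
theorem ι_injective (hφ : Function.Injective φ) : Function.Injective (ι (n := n) φ) := by
  intro u v h
  apply Units.ext
  have h1 : Mφ φ (u : Matrix n n R) = Mφ φ (v : Matrix n n R) := by
    rw [← coe_ι, ← coe_ι, h]
  exact Matrix.map_injective hφ h1

/-- The arithmetic subgroup `𝒢(R) ≤ 𝒢`: the elements of `𝒢` that are images of invertible `R`-matrices
(matrix AND inverse matrix with entries in `φ(R)`). -/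
def arith : Subgroup 𝒢 := (ι (n := n) φ).range.comap 𝒢.subtype

/-- `g ∈ 𝒢(R)` iff `g` is the image of an invertible `R`-matrix. -/
theorem mem_arith {g : 𝒢} : g ∈ arith 𝒢 φ ↔ ∃ u : (Matrix n n R)ˣ, ι φ u = (g : GL n F) := Iff.rfl

/-- An element of `𝒢` whose matrix is the image of an invertible `R`-matrix lies in `𝒢(R)`. -/
theorem mem_arith_of {g : 𝒢} (u : (Matrix n n R)ˣ) (hu : Mφ φ (u : Matrix n n R) = matG 𝒢 g) :
    g ∈ arith 𝒢 φ :=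
  ⟨u, Units.ext hu⟩

variable (hφ : Function.Injective φ)

/-- The invertible `R`-matrix underlying an element of `𝒢(R)` (unique, `φ` being injective). -/
def lift (g : arith 𝒢 φ) : (Matrix n n R)ˣ := Classical.choose ((mem_arith 𝒢 φ).mp g.2)

/-- `ι (lift g) = g`. -/
theorem ι_lift (g : arith 𝒢 φ) : ι φ (lift 𝒢 φ g) = ((g : 𝒢) : GL n F) :=
  Classical.choose_spec ((mem_arith 𝒢 φ).mp g.2)

include hφ in
/-- `lift` is determined by its image. -/
theorem lift_eq_of_ι_eq {g : arith 𝒢 φ} {u : (Matrix n n R)ˣ} (h : ι φ u = ((g : 𝒢) : GL n F)) :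
    lift 𝒢 φ g = u :=
  ι_injective φ hφ (by rw [ι_lift, h])

include hφ in
/-- `lift` is multiplicative. -/
theorem lift_mul (g h : arith 𝒢 φ) : lift 𝒢 φ (g * h) = lift 𝒢 φ g * lift 𝒢 φ h := by
  apply ι_injective φ hφ
  rw [map_mul, ι_lift, ι_lift, ι_lift]
  rfl

include hφ in
/-- `lift 1 = 1`. -/
theorem lift_one : lift 𝒢 φ (1 : arith 𝒢 φ) = 1 := by
  apply ι_injective φ hφ
  rw [map_one, ι_lift]
  rfl

/-- `lift` as a group homomorphism `𝒢(R) → GL_n(R)`. -/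
def liftHom : arith 𝒢 φ →* (Matrix n n R)ˣ where
  toFun := lift 𝒢 φ
  map_one' := lift_one 𝒢 φ hφ
  map_mul' := lift_mul 𝒢 φ hφ

/-- The matrix of `g ∈ 𝒢(R)` is the image of its lift. -/
theorem matG_eq_Mφ_lift (g : arith 𝒢 φ) : matG 𝒢 (g : 𝒢) = Mφ φ (lift 𝒢 φ g : Matrix n n R) := by
  rw [← coe_ι, ι_lift]

/-- Reduction modulo `K`: the group homomorphism `𝒢(R) → GL_n(R/K)`. -/
def red (K : R) : arith 𝒢 φ →* (Matrix n n (R ⧸ Ideal.span {K}))ˣ :=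
  (Units.map (Ideal.Quotient.mk (Ideal.span {K})).mapMatrix.toMonoidHom).comp (liftHom 𝒢 φ hφ)

/-- The matrix of `red K g` is the reduction of the matrix of `lift g`. -/
theorem coe_red (K : R) (g : arith 𝒢 φ) :
    ((red 𝒢 φ hφ K g : (Matrix n n (R ⧸ Ideal.span {K}))ˣ) : Matrix n n (R ⧸ Ideal.span {K})) =
      (lift 𝒢 φ g : Matrix n n R).map (Ideal.Quotient.mk (Ideal.span {K})) := rfl

/-- The principal congruence subgroup `Γ(K)`, as a subgroup of `𝒢(R)`: the kernel of the reduction. -/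
def congrSub (K : R) : Subgroup (arith 𝒢 φ) := (red 𝒢 φ hφ K).ker

/-- The principal congruence subgroup `Γ(K)`, as a subgroup of `𝒢`. -/
def congr (K : R) : Subgroup 𝒢 := (congrSub 𝒢 φ hφ K).map (arith 𝒢 φ).subtype

/-- `Γ(K) ≤ 𝒢(R)`. -/
theorem congr_le_arith (K : R) : congr 𝒢 φ hφ K ≤ arith 𝒢 φ := Subgroup.map_subtype_le _

/-- `Γ(K)` viewed inside `𝒢(R)` is the kernel of the reduction. -/
theorem congr_subgroupOf_arith (K : R) : (congr 𝒢 φ hφ K).subgroupOf (arith 𝒢 φ) = congrSub 𝒢 φ hφ K :=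
  Subgroup.comap_map_eq_self_of_injective (arith 𝒢 φ).subtype_injective _

/-- **Finite index.**  When `R/K` is finite, `Γ(K)` has finite index in `𝒢(R)`. -/
theorem isFiniteRelIndex_congr (K : R) [Finite (R ⧸ Ideal.span {K})] :
    (congr 𝒢 φ hφ K).IsFiniteRelIndex (arith 𝒢 φ) := by
  rw [Subgroup.isFiniteRelIndex_iff_finiteIndex, congr_subgroupOf_arith]
  exact Subgroup.finiteIndex_ker _

/-! ### Integral presentations of the elements of `Γ(K)` -/

include hφ in
/-- `C * D = 1` in `M_n(R)` as soon as it holds after `φ`. -/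
theorem mul_eq_one_of_Mφ {C D : Matrix n n R} (h : Mφ φ C * Mφ φ D = 1) : C * D = 1 := by
  have h1 : Mφ φ (C * D) = Mφ φ 1 := by rw [map_mul, h, map_one]
  exact Matrix.map_injective hφ h1

/-- The invertible `R`-matrix with entries `C`, inverse `D`, built from the relations after `φ`. -/
def unitOf (C D : Matrix n n R) (h1 : Mφ φ C * Mφ φ D = 1) (h2 : Mφ φ D * Mφ φ C = 1) : (Matrix n n R)ˣ :=
  ⟨C, D, mul_eq_one_of_Mφ φ hφ h1, mul_eq_one_of_Mφ φ hφ h2⟩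

/-- The matrix of `unitOf C D` is `C`. -/
theorem coe_unitOf (C D : Matrix n n R) (h1 : Mφ φ C * Mφ φ D = 1) (h2 : Mφ φ D * Mφ φ C = 1) :
    ((unitOf φ hφ C D h1 h2 : (Matrix n n R)ˣ) : Matrix n n R) = C := rfl

omit [Fintype n] hφ in
/-- `1 + K • C` reduces to `1` modulo `K`. -/
theorem map_one_add_smul (K : R) (C : Matrix n n R) :
    (1 + K • C).map (Ideal.Quotient.mk (Ideal.span {K})) = 1 := by
  ext i j
  simp [Matrix.map_apply, Matrix.one_apply]

omit [Fintype n] hφ in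
/-- A matrix reducing to `1` modulo `K` is `1 + K • C` for some `C`. -/
theorem exists_eq_one_add_smul {K : R} {v : Matrix n n R}
    (hv : v.map (Ideal.Quotient.mk (Ideal.span {K})) = 1) : ∃ C, v = 1 + K • C := by
  have h : ∀ i j, ∃ c, c * K = v i j - (1 : Matrix n n R) i j := by
    intro i j
    rw [← Ideal.mem_span_singleton', ← Ideal.Quotient.eq_zero_iff_mem, map_sub]
    have hij : Ideal.Quotient.mk (Ideal.span {K}) (v i j) = (1 : Matrix n n _) i j := by
      have := congrFun (congrFun hv i) j
      rwa [Matrix.map_apply] at this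
    rw [hij]
    simp [Matrix.one_apply]
  choose c hc using h
  refine ⟨Matrix.of fun i j => c i j, ?_⟩
  ext i j
  simp only [Matrix.add_apply, Matrix.smul_apply, Matrix.of_apply, smul_eq_mul]
  linear_combination -(hc i j)

/-- **Membership in `Γ(K)` from an integral presentation**: `matG g = φ(1 + K • C)` and
`matG g⁻¹ = φ(1 + K • D)` give `g ∈ Γ(K)`. -/
theorem mem_congr_of {g : 𝒢} {K : R} {C D : Matrix n n R} (hC : matG 𝒢 g = Mφ φ (1 + K • C))
    (hD : matG 𝒢 g⁻¹ = Mφ φ (1 + K • D)) : g ∈ congr 𝒢 φ hφ K := by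
  have h1 : Mφ φ (1 + K • C) * Mφ φ (1 + K • D) = 1 := by rw [← hC, ← hD, matG_mul_inv]
  have h2 : Mφ φ (1 + K • D) * Mφ φ (1 + K • C) = 1 := by rw [← hC, ← hD, matG_inv_mul]
  have hg : g ∈ arith 𝒢 φ := mem_arith_of 𝒢 φ (unitOf φ hφ _ _ h1 h2) hC.symm
  refine ⟨⟨g, hg⟩, MonoidHom.mem_ker.mpr ?_, rfl⟩
  apply Units.ext
  rw [coe_red, lift_eq_of_ι_eq 𝒢 φ hφ (g := ⟨g, hg⟩) (u := unitOf φ hφ _ _ h1 h2) (Units.ext hC.symm),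
    coe_unitOf, Units.val_one]
  exact map_one_add_smul K C

/-- **Integral presentation of an element of `Γ(K)`.** -/
theorem exists_of_mem_congr {g : 𝒢} {K : R} (hg : g ∈ congr 𝒢 φ hφ K) :
    ∃ C D : Matrix n n R, matG 𝒢 g = Mφ φ (1 + K • C) ∧ matG 𝒢 g⁻¹ = Mφ φ (1 + K • D) := by
  obtain ⟨x, hx', rfl⟩ := hg
  have hx : red 𝒢 φ hφ K x = 1 := MonoidHom.mem_ker.mp hx'
  have hx2 : red 𝒢 φ hφ K x⁻¹ = 1 := by rw [map_inv, hx, inv_one]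
  have hu : (lift 𝒢 φ x : Matrix n n R).map (Ideal.Quotient.mk (Ideal.span {K})) = 1 := by
    have := congrArg Units.val hx
    rwa [coe_red, Units.val_one] at this
  have hu' : (lift 𝒢 φ x⁻¹ : Matrix n n R).map (Ideal.Quotient.mk (Ideal.span {K})) = 1 := by
    have := congrArg Units.val hx2
    rwa [coe_red, Units.val_one] at this
  obtain ⟨C, hC⟩ := exists_eq_one_add_smul hu
  obtain ⟨D, hD⟩ := exists_eq_one_add_smul hu'
  refine ⟨C, D, ?_, ?_⟩
  · show matG 𝒢 (x : 𝒢) = _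
    rw [matG_eq_Mφ_lift, hC]
  · show matG 𝒢 ((x : 𝒢))⁻¹ = _
    have : ((x : 𝒢))⁻¹ = ((x⁻¹ : arith 𝒢 φ) : 𝒢) := rfl
    rw [this, matG_eq_Mφ_lift, hD]

/-! ### Hecke conjugation and the finite-index clause -/

/-- `Γ(K) ≤ Γ(M)` when `M ∣ K`. -/
theorem congr_le_congr_of_dvd {K M : R} (h : M ∣ K) : congr 𝒢 φ hφ K ≤ congr 𝒢 φ hφ M := by
  intro g hg
  obtain ⟨C, D, hC, hD⟩ := exists_of_mem_congr 𝒢 φ hφ hg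
  obtain ⟨c, rfl⟩ := h
  exact mem_congr_of 𝒢 φ hφ (C := c • C) (D := c • D) (by rw [hC, mul_smul]) (by rw [hD, mul_smul])

omit hφ in
/-- The conjugation computation: `g · φ(1 + N²M • X) · g⁻¹ = φ(1 + M • (A X B))` when `φ A = N • matG g` and
`φ B = N • matG g⁻¹`. -/
theorem conj_Mφ_eq (g : 𝒢) (N M : R) (A B : Matrix n n R) (hA : Mφ φ A = φ N • matG 𝒢 g)
    (hB : Mφ φ B = φ N • matG 𝒢 g⁻¹) (X : Matrix n n R) :
    matG 𝒢 g * Mφ φ (1 + (N ^ 2 * M) • X) * matG 𝒢 g⁻¹ = Mφ φ (1 + M • (A * X * B)) := by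
  have hgg := matG_mul_inv 𝒢 g
  simp only [map_add, map_one, Mφ_smul, map_mul, map_pow, hA, hB, Matrix.mul_add, Matrix.add_mul,
    Matrix.mul_one, Matrix.mul_smul, Matrix.smul_mul, smul_smul, hgg]
  congr 2
  ring

/-- **Hecke conjugation.**  If `N · g` and `N · g⁻¹` are integral then `g Γ(N² M) g⁻¹ ≤ Γ(M)`, i.e.
`Γ(N² M) ≤ g⁻¹ Γ(M) g`. -/
theorem congr_le_conjSubG (g : 𝒢) (N M : R) (A B : Matrix n n R) (hA : Mφ φ A = φ N • matG 𝒢 g)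
    (hB : Mφ φ B = φ N • matG 𝒢 g⁻¹) : congr 𝒢 φ hφ (N ^ 2 * M) ≤ conjSubG g (congr 𝒢 φ hφ M) := by
  intro δ hδ
  rw [mem_conjSubG]
  obtain ⟨C, D, hC, hD⟩ := exists_of_mem_congr 𝒢 φ hφ hδ
  refine mem_congr_of 𝒢 φ hφ (C := A * C * B) (D := A * D * B) ?_ ?_
  · rw [matG_mul, matG_mul, hC, conj_Mφ_eq 𝒢 φ g N M A B hA hB]
  · rw [_root_.mul_inv_rev, _root_.mul_inv_rev, inv_inv, matG_mul, matG_mul, hD, ← Matrix.mul_assoc,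
      conj_Mφ_eq 𝒢 φ g N M A B hA hB]

/-- **The congruence half**: `Γ(N² M) ≤ Γ′ ⊓ g⁻¹ Γ′ g` for `Γ(M) ≤ Γ′` and a Hecke element `g`. -/
theorem congr_le_inf_conjSubG {Γ' : Subgroup 𝒢} {M : R} (hM : congr 𝒢 φ hφ M ≤ Γ') (g : 𝒢) {N : R}
    (A B : Matrix n n R) (hA : Mφ φ A = φ N • matG 𝒢 g) (hB : Mφ φ B = φ N • matG 𝒢 g⁻¹) :
    congr 𝒢 φ hφ (N ^ 2 * M) ≤ Γ' ⊓ conjSubG g Γ' :=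
  le_inf ((congr_le_congr_of_dvd 𝒢 φ hφ (Dvd.intro_left _ rfl)).trans hM)
    ((congr_le_conjSubG 𝒢 φ hφ g N M A B hA hB).trans (conjSubG_mono g hM))

/-- **The finite-index clause of Lemma W (ROUTE.md A4), generic form.**  `Γ(M) ≤ Γ′ ≤ 𝒢(R)`, `R/(N² M)`
finite, `g ∈ 𝒢` with `N · g`, `N · g⁻¹` integral ⇒ `Γ′ ⊓ g⁻¹ Γ′ g` has finite index in `Γ′`. -/
theorem isFiniteRelIndex_inf_conjSubG {Γ' : Subgroup 𝒢} (hΓ : Γ' ≤ arith 𝒢 φ) {M : R}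
    (hM : congr 𝒢 φ hφ M ≤ Γ') (g : 𝒢) {N : R} (A B : Matrix n n R) (hA : Mφ φ A = φ N • matG 𝒢 g)
    (hB : Mφ φ B = φ N • matG 𝒢 g⁻¹) [Finite (R ⧸ Ideal.span {N ^ 2 * M})] :
    (Γ' ⊓ conjSubG g Γ').IsFiniteRelIndex Γ' := by
  haveI : (congr 𝒢 φ hφ (N ^ 2 * M)).IsFiniteRelIndex (arith 𝒢 φ) := isFiniteRelIndex_congr 𝒢 φ hφ _
  haveI : (congr 𝒢 φ hφ (N ^ 2 * M)).IsFiniteRelIndex Γ' :=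
    Subgroup.isFiniteRelIndex_of_le_right (congr 𝒢 φ hφ (N ^ 2 * M)) hΓ
  exact Subgroup.isFiniteRelIndex_of_le_left Γ' (congr_le_inf_conjSubG 𝒢 φ hφ hM g A B hA hB)

end cong

end CongGen

end Summit.Ventures.HodgeRepro

end
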